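import Mathlib
import HarnessLib
import Summits.Ventures.LatticeQCDFlow.Scoring.IMHGreenKubo

/-!
# Weight-blind observables of the exact flow-MCMC (IMH) chain: `C_f(t) = Var(f)·E_p[(1 − a)ᵗ]`,
# `τ_int(f) = E_p[1/a] − 1/2 ≥ 1/ā − 1/2`

HONEST FRAMING: exact (Metropolis-corrected) sampling algorithms for lattice gauge theory;
figures of merit are autocorrelation/cost numbers at stated couplings and volumes; no
continuum-physics claim.

Venture `LatticeQCDFlow` (cell pub-lqcd), topic `Scoring`; FANOUT row 8 (`s0-cpn-nemc`, GEN-9).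
NEW WORK of the cell (elementary finite sums and finite mixtures of geometric series), not a
published result; it types statement (T3) of the flow seat's `HOME/canary-flow/imhlaw/IMH-LAW-flow.md`
('weight-blind observables') on the tree's objects `Exactness.imhKernel`, `Scoring.imhMatrix ·
twoTime · mv · tauInt · liuG`, `Exactness.accRate`; nothing is cited as a fact and no definition is
added (the move-acceptance `a(x)` is written `1 − liuG p q x x`, file `IMHPoissonTransfer.lean`).

## Setting

A finite product state space `L × Y` ('level' × 'label'): target `p (l, y) = pL l · μ y` and model
`q (l, y) = qL l · μ y` share the label law `μ` (a probability vector), so the importance weight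
`w = p/q = pL/qL` is a function of the level alone and the label is independent of the weight under
both laws — the finite form of (T3)'s hypothesis '`f` independent of `W` under `q`'.  A WEIGHT-BLIND
observable is `f (l, y) = g y` with `Σ_y μ y g y = 0` (centred under the label law, hence under `p`).

## Content

* `imh_mv_eq_liuG_diag_mul` (any finite space) — if `Σ_z min(q z, p z q x / p x) · h z = 0` for every
  `x` (the observable is invisible to the proposal-weighted acceptance average), the exact chain acts
  on `h` DIAGONALLY: `(K h)(x) = G x x · h x = (1 − a(x)) h x`.
* `blind_liuG_diag` — on the product space the move-acceptance depends on the level only,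
  `1 − G (l,y) (l,y) = a(l) := 1 − liuG pL qL l l`; `blind_mv_pow`: for `h = φ ⊗ g` with `g`
  `μ`-centred, `Kᵗ h = ((1 − a)ᵗ φ) ⊗ g`.
* **`blind_twoTime_eq`** — (T3): `S_t(f, f) = (Σ_l pL l (1 − a l)ᵗ) · (Σ_y μ y g y²)`, i.e.
  `C_f(t) = Var(f) · E_p[(1 − a(W))ᵗ]` — the autocorrelation of a weight-blind observable is the
  stationary probability of `t` consecutive rejections, whatever `g` is.
* **`blind_tauInt_eq`** — `τ_int(f) = Σ_l pL l / a l − 1/2 = E_p[1/a(W)] − 1/2` on the tree's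
  `tauInt` (finite mixture of geometric series; `a l ∈ (0, 1]` for `qL > 0`), for every non-constant
  weight-blind `f` — the flow seat's `τ_blind`.
* `sum_mul_moveAccept_eq_accRate` — `E_p[a(W)] = Σ_l pL l · a l = Exactness.accRate pL qL = ā`, the
  stationary acceptance rate; **`blind_tauInt_ge`** — JENSEN: `τ_int(f) ≥ 1/ā − 1/2` (Cauchy–Schwarz
  `(Σ pL)² ≤ (Σ pL a)(Σ pL/a)`): acceptance alone bounds the weight-blind `τ` from BELOW, never above
  (the upper side is `w⋆ − 1/2`, `IMHAutocorrelationEnvelope.imh_tauInt_le`).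
-/

namespace Summit.Ventures.LatticeQCDFlow.Scoring

open Finset Literature.Probability.MarkovChains Summit.Ventures.LatticeQCDFlow.Exactness

/-! ### Any finite space: observables invisible to the acceptance average evolve diagonally -/

section Diagonal

variable {X : Type*} [Fintype X] [DecidableEq X]

/-- If `Σ_z min(q z, p z q x / p x) · h z = 0` for every state `x`, the exact flow-MCMC chain acts
on `h` diagonally: `(K h)(x) = G x x · h x` with `G = liuG p q` (`G x x = 1 − a(x)`, one minus the
move-acceptance out of `x`). -/
theorem imh_mv_eq_liuG_diag_mul {p q : X → ℝ} (hp : ∀ x, 0 < p x) (h : X → ℝ)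
    (hh : ∀ x, ∑ z, min (q z) (p z * q x / p x) * h z = 0) (x : X) :
    mv (imhMatrix p q) h x = liuG p q x x * h x := by
  have hoff : ∀ z ∈ univ.erase x, imhKernel p q x z * h z = min (q z) (p z * q x / p x) * h z := by
    intro z hz
    unfold imhKernel
    rw [mhKernel_of_ne (ne_of_mem_erase hz)]
    rfl
  have hxx : min (q x) (p x * q x / p x) = q x := by
    rw [mul_div_cancel_left₀ _ (hp x).ne', min_self]
  have hfull := hh x
  rw [← add_sum_erase _ _ (mem_univ x), hxx] at hfull
  unfold mv
  simp only [imhMatrix_apply]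
  rw [← add_sum_erase _ _ (mem_univ x), sum_congr rfl hoff]
  unfold liuG rankOneSplit
  linarith

end Diagonal

/-! ### The product space `level × label` -/

section Blind

variable {L Y : Type*} [Fintype L] [DecidableEq L] [Fintype Y] [DecidableEq Y]
variable {pL qL : L → ℝ} {μ : Y → ℝ}

omit [Fintype L] [DecidableEq L] [Fintype Y] [DecidableEq Y] in
/-- The proposal-weighted acceptance factor on the product space factors through the label law:
`min(q z, p z q x / p x) = μ z.2 · min(qL z.1, pL z.1 qL x.1 / pL x.1)`. -/
theorem blind_min_eq (hpL : ∀ l, 0 < pL l) (hμ : ∀ y, 0 < μ y) (x z : L × Y) :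
    min (qL z.1 * μ z.2) (pL z.1 * μ z.2 * (qL x.1 * μ x.2) / (pL x.1 * μ x.2))
      = μ z.2 * min (qL z.1) (pL z.1 * qL x.1 / pL x.1) := by
  have h1 : pL x.1 ≠ 0 := (hpL x.1).ne'
  have h2 : μ x.2 ≠ 0 := (hμ x.2).ne'
  rw [(monotone_mul_left_of_nonneg (hμ z.2).le).map_min]
  congr 1
  · ring
  · field_simp

omit [DecidableEq L] [DecidableEq Y] in
/-- A product observable `φ ⊗ g` with `g` centred under the label law is invisible to the acceptance
average: `Σ_z min(q z, p z q x / p x) · φ z.1 g z.2 = 0`. -/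
theorem blind_rate_sum_eq_zero (hpL : ∀ l, 0 < pL l) (hμ : ∀ y, 0 < μ y) (φ : L → ℝ) {g : Y → ℝ}
    (hg : ∑ y, μ y * g y = 0) (x : L × Y) :
    ∑ z : L × Y, min (qL z.1 * μ z.2) (pL z.1 * μ z.2 * (qL x.1 * μ x.2) / (pL x.1 * μ x.2))
      * (φ z.1 * g z.2) = 0 := by
  simp_rw [blind_min_eq hpL hμ x]
  rw [Fintype.sum_prod_type]
  have h : ∀ l', ∑ y', μ y' * min (qL l') (pL l' * qL x.1 / pL x.1) * (φ l' * g y')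
      = min (qL l') (pL l' * qL x.1 / pL x.1) * φ l' * ∑ y', μ y' * g y' := by
    intro l'
    rw [mul_sum]
    exact sum_congr rfl fun y' _ => by ring
  simp_rw [h, hg, mul_zero, sum_const_zero]

/-- On the product space the move-acceptance out of `(l, y)` depends on the level only:
`liuG p q (l,y) (l,y) = liuG pL qL l l` (`Σ μ = 1`). -/
theorem blind_liuG_diag (hpL : ∀ l, 0 < pL l) (hμ : ∀ y, 0 < μ y) (hμ1 : ∑ y, μ y = 1)
    (x : L × Y) :
    liuG (fun z : L × Y => pL z.1 * μ z.2) (fun z => qL z.1 * μ z.2) x x = liuG pL qL x.1 x.1 := by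
  have h1 : 1 - liuG (fun z : L × Y => pL z.1 * μ z.2) (fun z => qL z.1 * μ z.2) x x
      = ∑ z : L × Y, min (qL z.1 * μ z.2) (pL z.1 * μ z.2 * (qL x.1 * μ x.2) / (pL x.1 * μ x.2)) :=
    one_sub_liuG_diag_eq_sum_min (p := fun z : L × Y => pL z.1 * μ z.2)
      (q := fun z : L × Y => qL z.1 * μ z.2) (fun z => mul_pos (hpL z.1) (hμ z.2)) x
  have h2 : 1 - liuG pL qL x.1 x.1 = ∑ l', min (qL l') (pL l' * qL x.1 / pL x.1) :=
    one_sub_liuG_diag_eq_sum_min hpL x.1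
  have h3 : ∑ z : L × Y, min (qL z.1 * μ z.2) (pL z.1 * μ z.2 * (qL x.1 * μ x.2) / (pL x.1 * μ x.2))
      = ∑ l', min (qL l') (pL l' * qL x.1 / pL x.1) := by
    simp_rw [blind_min_eq hpL hμ x]
    rw [Fintype.sum_prod_type]
    refine sum_congr rfl fun l' _ => ?_
    have hy : ∀ y, μ (l', y).2 * min (qL (l', y).1) (pL (l', y).1 * qL x.1 / pL x.1)
        = μ y * min (qL l') (pL l' * qL x.1 / pL x.1) := fun y => rfl
    rw [sum_congr rfl fun y _ => hy y, ← sum_mul, hμ1, one_mul]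
  linarith

/-- **`Kᵗ (φ ⊗ g) = ((1 − a)ᵗ φ) ⊗ g`** for a label-centred `g`: the exact chain multiplies a
weight-blind centred observable by the rejection probability of its level, step after step. -/
theorem blind_mv_pow (hpL : ∀ l, 0 < pL l) (hμ : ∀ y, 0 < μ y) (hμ1 : ∑ y, μ y = 1) (φ : L → ℝ)
    {g : Y → ℝ} (hg : ∑ y, μ y * g y = 0) : ∀ t : ℕ,
    mv (imhMatrix (fun z : L × Y => pL z.1 * μ z.2) (fun z => qL z.1 * μ z.2) ^ t)
        (fun z => φ z.1 * g z.2)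
      = fun z => liuG pL qL z.1 z.1 ^ t * φ z.1 * g z.2 := by
  intro t
  induction t with
  | zero => funext z; simp [mv_one]
  | succ t ih =>
    rw [pow_succ', mv_mul, ih]
    funext x
    have h := imh_mv_eq_liuG_diag_mul (p := fun z : L × Y => pL z.1 * μ z.2)
      (q := fun z => qL z.1 * μ z.2) (fun z => mul_pos (hpL z.1) (hμ z.2))
      (fun z => liuG pL qL z.1 z.1 ^ t * φ z.1 * g z.2)
      (fun x => blind_rate_sum_eq_zero hpL hμ (fun l => liuG pL qL l l ^ t * φ l) hg x) x
    rw [h, blind_liuG_diag hpL hμ hμ1 x]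
    ring

/-- **IMH-LAW (T3): `C_f(t) = Var(f) · E_p[(1 − a(W))ᵗ]`** — for a weight-blind observable
`f (l, y) = g y` centred under the label law, the two-time form of the exact chain is
`S_t(f, f) = (Σ_l pL l · (liuG pL qL l l)ᵗ) · (Σ_y μ y · g y²)`. -/
theorem blind_twoTime_eq (hpL : ∀ l, 0 < pL l) (hμ : ∀ y, 0 < μ y) (hμ1 : ∑ y, μ y = 1)
    {g : Y → ℝ} (hg : ∑ y, μ y * g y = 0) (t : ℕ) :
    twoTime (fun z : L × Y => pL z.1 * μ z.2)
        (imhMatrix (fun z : L × Y => pL z.1 * μ z.2) (fun z => qL z.1 * μ z.2)) t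
        (fun z => g z.2) (fun z => g z.2)
      = (∑ l, pL l * liuG pL qL l l ^ t) * ∑ y, μ y * g y ^ 2 := by
  have hf : (fun z : L × Y => g z.2) = fun z => (fun _ : L => (1 : ℝ)) z.1 * g z.2 := by
    funext z; simp
  unfold twoTime
  rw [hf, blind_mv_pow hpL hμ hμ1 (fun _ => (1 : ℝ)) hg t, Fintype.sum_prod_type, sum_mul]
  refine sum_congr rfl fun l _ => ?_
  rw [mul_sum]
  exact sum_congr rfl fun y _ => by ring

/-- The move-acceptance `a(l) = 1 − liuG pL qL l l` is at most `1` (`Σ qL = 1`). -/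
theorem one_sub_liuG_diag_le_one (hpL : ∀ l, 0 < pL l) (hqL1 : ∑ l, qL l = 1) (l : L) :
    1 - liuG pL qL l l ≤ 1 := by
  rw [one_sub_liuG_diag_eq_sum_min hpL l, ← hqL1]
  exact sum_le_sum fun z _ => min_le_left _ _

/-- **`τ_int(f) = E_p[1/a(W)] − 1/2`** (the flow seat's `τ_blind`): for every weight-blind
observable with `Var(g) ≠ 0` under a positive model law,
`tauInt ρ_f = Σ_l pL l / (1 − liuG pL qL l l) − 1/2` — a finite mixture of geometric series, no
window. -/
theorem blind_tauInt_eq (hpL : ∀ l, 0 < pL l) (hpL1 : ∑ l, pL l = 1) (hqL : ∀ l, 0 < qL l)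
    (hqL1 : ∑ l, qL l = 1) (hμ : ∀ y, 0 < μ y) (hμ1 : ∑ y, μ y = 1) {g : Y → ℝ}
    (hg : ∑ y, μ y * g y = 0) (hvar : ∑ y, μ y * g y ^ 2 ≠ 0) :
    tauInt (fun t => twoTime (fun z : L × Y => pL z.1 * μ z.2)
        (imhMatrix (fun z : L × Y => pL z.1 * μ z.2) (fun z => qL z.1 * μ z.2)) t
        (fun z => g z.2) (fun z => g z.2) /
      twoTime (fun z : L × Y => pL z.1 * μ z.2)
        (imhMatrix (fun z : L × Y => pL z.1 * μ z.2) (fun z => qL z.1 * μ z.2)) 0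
        (fun z => g z.2) (fun z => g z.2))
      = ∑ l, pL l / (1 - liuG pL qL l l) - 1 / 2 := by
  simp_rw [blind_twoTime_eq hpL hμ hμ1 hg]
  have h0 : ∑ l, pL l * liuG pL qL l l ^ 0 = 1 := by simp [hpL1]
  have hρ : ∀ t, (∑ l, pL l * liuG pL qL l l ^ t) * (∑ y, μ y * g y ^ 2) /
      ((∑ l, pL l * liuG pL qL l l ^ 0) * ∑ y, μ y * g y ^ 2) = ∑ l, pL l * liuG pL qL l l ^ t := by
    intro t
    rw [h0, one_mul, mul_div_cancel_right₀ _ hvar]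
  simp_rw [hρ]
  -- the mixture of geometric series
  have ha : ∀ l, 0 < 1 - liuG pL qL l l := fun l => one_sub_liuG_diag_pos hpL hqL l
  have hgeo : ∀ l ∈ (univ : Finset L), HasSum (fun t : ℕ => pL l * liuG pL qL l l ^ (t + 1))
      (pL l * (liuG pL qL l l / (1 - liuG pL qL l l))) := by
    intro l _
    refine (hasSum_geometric_succ ?_).mul_left (pL l)
    have h1 := one_sub_liuG_diag_le_one hpL hqL1 l
    rw [abs_lt]
    constructor <;> linarith [ha l]
  have hsum := hasSum_sum hgeo
  unfold tauInt
  rw [hsum.tsum_eq]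
  have hterm : ∀ l, pL l * (liuG pL qL l l / (1 - liuG pL qL l l)) = pL l / (1 - liuG pL qL l l) - pL l :=
    fun l => by
      have := (ha l).ne'
      field_simp
      ring
  simp_rw [hterm, sum_sub_distrib, hpL1]
  ring

/-- **`E_p[a(W)] = ā`**: the `p`-average of the move-acceptance is the stationary acceptance rate
`Exactness.accRate pL qL = Σ_{l,l'} min(pL l qL l', pL l' qL l)`. -/
theorem sum_mul_moveAccept_eq_accRate (hpL : ∀ l, 0 < pL l) :
    ∑ l, pL l * (1 - liuG pL qL l l) = accRate pL qL := by
  unfold accRate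
  refine sum_congr rfl fun l _ => ?_
  rw [one_sub_liuG_diag_eq_sum_min hpL l, mul_sum]
  refine sum_congr rfl fun z _ => ?_
  rw [(monotone_mul_left_of_nonneg (hpL l).le).map_min]
  congr 1
  rw [mul_div_assoc', mul_div_cancel_left₀ _ (hpL l).ne', mul_comm]

/-- JENSEN: `E_p[1/a] ≥ 1/E_p[a]`, i.e. `Σ_l pL l / a l ≥ 1 / accRate pL qL`. -/
theorem inv_accRate_le_sum_div (hpL : ∀ l, 0 < pL l) (hpL1 : ∑ l, pL l = 1) (hqL : ∀ l, 0 < qL l) :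
    1 / accRate pL qL ≤ ∑ l, pL l / (1 - liuG pL qL l l) := by
  have ha : ∀ l, 0 < 1 - liuG pL qL l l := fun l => one_sub_liuG_diag_pos hpL hqL l
  have hCS : (∑ l, pL l) ^ 2 ≤ (∑ l, pL l * (1 - liuG pL qL l l)) * ∑ l, pL l / (1 - liuG pL qL l l) :=
    sum_sq_le_sum_mul_sum_of_sq_le_mul univ (fun l _ => mul_nonneg (hpL l).le (ha l).le)
      (fun l _ => div_nonneg (hpL l).le (ha l).le)
      (fun l _ => le_of_eq (by
        rw [mul_assoc, mul_div_assoc', mul_div_cancel_left₀ _ (ha l).ne', sq]))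
  rw [hpL1, one_pow, sum_mul_moveAccept_eq_accRate hpL] at hCS
  have hne : (univ : Finset L).Nonempty :=
    nonempty_of_sum_ne_zero (by rw [hpL1]; exact one_ne_zero)
  have hacc : 0 < accRate pL qL := by
    rw [← sum_mul_moveAccept_eq_accRate hpL]
    exact sum_pos (fun l _ => mul_pos (hpL l) (ha l)) hne
  rw [div_le_iff₀ hacc, mul_comm]
  exact hCS

/-- **JENSEN FLOOR `τ_int(f) ≥ 1/ā − 1/2`** for every non-constant weight-blind observable of the
exact flow-MCMC chain with a positive model law: the stationary acceptance rate bounds the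
weight-blind integrated autocorrelation time from below (and `imh_tauInt_le` bounds it from above by
`w⋆ − 1/2`). -/
theorem blind_tauInt_ge (hpL : ∀ l, 0 < pL l) (hpL1 : ∑ l, pL l = 1) (hqL : ∀ l, 0 < qL l)
    (hqL1 : ∑ l, qL l = 1) (hμ : ∀ y, 0 < μ y) (hμ1 : ∑ y, μ y = 1) {g : Y → ℝ}
    (hg : ∑ y, μ y * g y = 0) (hvar : ∑ y, μ y * g y ^ 2 ≠ 0) :
    1 / accRate pL qL - 1 / 2 ≤
      tauInt (fun t => twoTime (fun z : L × Y => pL z.1 * μ z.2)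
        (imhMatrix (fun z : L × Y => pL z.1 * μ z.2) (fun z => qL z.1 * μ z.2)) t
        (fun z => g z.2) (fun z => g z.2) /
      twoTime (fun z : L × Y => pL z.1 * μ z.2)
        (imhMatrix (fun z : L × Y => pL z.1 * μ z.2) (fun z => qL z.1 * μ z.2)) 0
        (fun z => g z.2) (fun z => g z.2)) := by
  rw [blind_tauInt_eq hpL hpL1 hqL hqL1 hμ hμ1 hg hvar]
  linarith [inv_accRate_le_sum_div hpL hpL1 hqL (qL := qL)]

end Blind

end Summit.Ventures.LatticeQCDFlow.Scoring
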